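import Literature.Geometry.DiscreteGeometry.DelsarteLinearProgrammingBound

/-!
# The icosahedron code bound `A(3, arccos(1/√5)) ≤ 12` (sharp Delsarte LP certificate over `ℚ(√5)`)

Framing: lottery ticket; floor = certified bounds/negative ranges. Venture `PackingBounds`
(cell `pub-packcert`), spherical-codes family, **+ control (irrational angle)**, recognition arm.

**Theorem (Levenshtein bound, tight case; cf. Levenshtein 1992, Cohn–Kumar 2007 Table 1).** Every
finite set of unit vectors of `ℝ³` with pairwise inner products `≤ 1/√5` has at most `12` elements;
the `12` vertices of the regular icosahedron attain this (they form a tight spherical `5`-design),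
so `A(3, arccos(1/√5)) = 12`. Certificate: `f(t) = λ (t+1)(t+1/√5)²(t-1/√5)` with
`λ = 75/8 - (15/8)√5 > 0`, Legendre coefficients (`μ = 1/2`, `C_k^{(1/2)} = P_k`)
`(f_0,…,f_4) = (1, 3, 20/7 + (3/7)√5, 3, 15/7 - (3/7)√5)`, all positive,
`Σ f_k P_k(1) = 12 = 12 f_0`.
The coefficients were recognised blind in `ℚ(√5)` by the cell's recognition pipeline
(`pub-packcert-recog`, exactrec client) from a 139-digit numerical LP optimum and re-verified
exactly (referee `lpcheck_nf.py`: CERTIFIED 12); this file is the kernel check.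

## References
* V. I. Levenshtein, *Designs as maximum codes in polynomial metric spaces*,
  Acta Appl. Math. 29 (1992) 1–82. [`Levenshtein1992` — see `Levenshtein1979` in references.bib]
* H. Cohn, A. Kumar, *Universally optimal distribution of points on spheres*, JAMS 20 (2007),
  Table 1. [`CohnKumar2006`]
-/

namespace Summit.Ventures.PackingBounds.Codes

open Finset Literature.Analysis.SpecialFunctions Literature.Geometry.DiscreteGeometry

/-- **`A(3, arccos(1/√5)) ≤ 12`**: a finite set of unit vectors of `ℝ³` with pairwise inner
products `≤ √5/5 = 1/√5` has at most `12` elements (sharp: the icosahedron).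
[cite: CohnKumar2006, Table 1] -/
theorem icosahedron_card_le_12 (C : Finset (EuclideanSpace ℝ (Fin 3)))
    (h1 : ∀ x ∈ C, ‖x‖ = 1)
    (h2 : ∀ x ∈ C, ∀ y ∈ C, x ≠ y → inner ℝ x y ≤ Real.sqrt 5 / 5) :
    C.card ≤ 12 := by
  have hX : Real.sqrt 5 ^ 2 = 5 := Real.sq_sqrt (by norm_num)
  have hlo : (2.2360679 : ℝ) < Real.sqrt 5 := (Real.lt_sqrt (by norm_num)).mpr (by norm_num)
  have hhi : Real.sqrt 5 < 2.236068 := (Real.sqrt_lt' (by norm_num)).mpr (by norm_num)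
  refine DelsarteLP.card_le (n := 3) (μ := 1 / 2) (by norm_num) (by norm_num) 4
      (fun k => match k with
        | 0 => (1 : ℝ)
        | 1 => (3 : ℝ)
        | 2 => (((20 : ℝ) / 7) + ((3 : ℝ) / 7) * Real.sqrt 5)
        | 3 => (3 : ℝ)
        | 4 => (((15 : ℝ) / 7) + ((-3 : ℝ) / 7) * Real.sqrt 5)
        | _ => 0)
    ?_ (Real.sqrt 5 / 5) ?_ 12 ?_ ?_ C h1 h2
  · intro k
    split <;> linarith [hlo, hhi]
  · intro t ht1 ht2
    have hsum : ∑ k ∈ range (4 + 1),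
      (fun k => match k with
        | 0 => (1 : ℝ)
        | 1 => (3 : ℝ)
        | 2 => (((20 : ℝ) / 7) + ((3 : ℝ) / 7) * Real.sqrt 5)
        | 3 => (3 : ℝ)
        | 4 => (((15 : ℝ) / 7) + ((-3 : ℝ) / 7) * Real.sqrt 5)
        | _ => 0) k * gegenbauerSum (1 / 2 : ℝ) k t =
        (((75 : ℝ) / 8) + ((-15 : ℝ) / 8) * Real.sqrt 5) * ((t + 1) * ((t + Real.sqrt 5 / 5) ^ 2 *
            (t - Real.sqrt 5 / 5))) := by
      simp [Finset.sum_range_succ, gegenbauerSum, gegenbauerCoeff, Finset.prod_range_succ,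
        Nat.factorial]
      linear_combination (((-3 : ℝ) / 40) + ((3 : ℝ) / 40) * Real.sqrt 5 ^ 1 + ((-3 : ℝ) / 200) *
          Real.sqrt 5 ^ 2 + ((3 : ℝ) / 10) * t ^ 1 + ((-3 : ℝ) / 200) * t ^ 1 * Real.sqrt 5 ^ 2 +
          ((3 : ℝ) / 4) * t ^ 2 + ((-3 : ℝ) / 40) * t ^ 2 * Real.sqrt 5 ^ 1 + ((3 : ℝ) / 8) * t ^
          3) * hX
    rw [hsum]
    have hlam : 0 ≤ (((75 : ℝ) / 8) + ((-15 : ℝ) / 8) * Real.sqrt 5) := by linarith [hlo, hhi]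
    have hP : (t + 1) * ((t + Real.sqrt 5 / 5) ^ 2 * (t - Real.sqrt 5 / 5)) ≤ 0 :=
      mul_nonpos_of_nonneg_of_nonpos (by linarith) (mul_nonpos_of_nonneg_of_nonpos (sq_nonneg _)
        (by linarith))
    exact mul_nonpos_of_nonneg_of_nonpos hlam hP
  · norm_num
  · have hv : ∑ k ∈ range (4 + 1),
      (fun k => match k with
        | 0 => (1 : ℝ)
        | 1 => (3 : ℝ)
        | 2 => (((20 : ℝ) / 7) + ((3 : ℝ) / 7) * Real.sqrt 5)
        | 3 => (3 : ℝ)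
        | 4 => (((15 : ℝ) / 7) + ((-3 : ℝ) / 7) * Real.sqrt 5)
        | _ => 0) k * gegenbauerSum (1 / 2 : ℝ) k 1 = 12 := by
      simp [Finset.sum_range_succ, gegenbauerSum, gegenbauerCoeff, Finset.prod_range_succ,
        Nat.factorial]
      ring
    rw [hv]
    norm_num

end Summit.Ventures.PackingBounds.Codes
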